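import Literature.Geometry.Symplectic.AlmostComplexStructure
import Literature.Geometry.Symplectic.JHolomorphicMap
import Literature.Geometry.Manifold.InjOnLocalDiffeomorphInverse
import Mathlib.Geometry.Manifold.Instances.Real
import Mathlib.LinearAlgebra.Complex.FiniteDimensional
import Literature.Geometry.Symplectic.JSphereMeetsEmbeddedJSphere
import Literature.Geometry.Symplectic.LeafCoordinateComplexLinearisation
import HarnessLib

/-!
# The leaf function of a smooth family of `J`-spheres, and the leaf coordinate package

C. Wendl, *Holomorphic Curves in Low Dimensions*, LNM 2216 (2018), **Prop. 2.53** (with its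
proof sketch, p. 65–66): near an embedded `J`-holomorphic sphere `u` with `[u] · [u] = 0` the
moduli space is a smooth `2`-manifold `𝒰` of embedded curves whose images foliate an open
neighbourhood, the evaluation map `𝒰 × S² → M` being a local diffeomorphism. This file is the
differential-topological bookkeeping that turns the OUTPUT of that statement — in the two-chart
form of `Literature.Geometry.Symplectic.hls_localFoliation_embeddedSphere_trivialNormal`
(`JSphereLocalFoliation.lean`): a family `(U a, V a)`, `|a| < ε`, of embedded `JX`-holomorphic
two-chart spheres, jointly `C^∞`, pairwise disjoint, with injective differentials of
`Φ_U (a, z) = U a z` and `Φ_V (a, w) = V a w` — into the INPUT of the local positivity of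
intersections statement `positivityOfIntersections_leafCoordinate`
(`PositivityOfIntersectionsLocal.lean`; Wendl §2.2.2, McDuff 1991 Thm. 1.1): a leaf coordinate
with complex linear differential at a prescribed point of a prescribed leaf. This is the
"uniqueness by positivity" half of the proof of Prop. 2.53 / Thm. 2.49 as used in that file.

## What is here

* `leafFunction U V ε : X → ℂ` (the one DEFINITION) — the leaf parameter `a` as a function on
  the swept set `⋃_{|a|<ε} (range (U a) ∪ {V a 0})`, read through the inverses of `Φ_U`, `Φ_V`
  (which are injective with bijective differentials, hence diffeomorphisms onto open images:
  the tree's `Literature.Geometry.Manifold.contMDiffOn_invFunOn_of_bijective_mfderiv`,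
  Lee 2013 Thm. 4.5); `leafFunction_apply_U/V` (`A (U a z) = a = A (V a w)`),
  `leafFunction_levelSet` (**the level sets are the leaves**), `contMDiffOn_leafFunction`
  (**`C^∞` on the swept set**), `isOpen_sweep`, `isPreconnected_sweep`,
  `surjective_mfderiv_leafFunction` (**a submersion**: `dA ∘ dΦ = pr₁`),
  `mfderiv_leafFunction_J_eq_zero` (**`ker dA_y` is the `J`-invariant tangent plane of the leaf**).
* The orientation sign of `dA` relative to `J` (`LeafCoordinateComplexLinearisation.lean`:
  `Q_y(v) = Im (dA_y(Jv) · conj (dA_y v))` has a sign independent of `v ∉ ker dA_y`):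
  `eventually_posAt_iff` — **locally constant in `y`** (in the chart at `y₀` it is the sign of
  the continuous non-vanishing `y ↦ D Â(φ y)(Ĵ(y) e) · conj (D Â(φ y) e)`, `Ĵ` the frame
  expression `inTangentCoordinates` of `J`, continuous at `y₀` for a smooth almost complex
  structure), `posAt_iff_posAt_of_isPreconnected`, `leafFunction_sign_const` — **constant on
  the (preconnected) swept set**.
* Post-composition with a real-linear automorphism `z ↦ α z + β z̄` of `ℂ`
  (`contMDiffOn_postCompose`, `mfderiv_postCompose_apply`, `surjective_mfderiv_postCompose`,
  `postCompose_eq_zero_iff`), and **`exists_leafCoordinateAt`**: for `|a₀| < ε` and `p` on the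
  leaf `a₀`, a regular `JX`-holomorphic local parametrisation `G` of the leaf at `p`
  (`exists_localParam_of_mem_twoChart`) and `α, β` (`exists_complexLinearisation`) such that
  `π = α (A - a₀) + β conj (A - a₀)` has complex linear differential at `p`, cuts out `G(V')`
  near `p` inside the swept set, and `|β| < |α|` iff the orientation sign at `p` is `+`
  (so that, by `wind_mul_add_mul_conj_of_norm_lt{,'}`, winding numbers of `π ∘ γ` and of
  `(A - a₀) ∘ γ` agree up to that constant sign).

## References

* C. Wendl, *Holomorphic Curves in Low Dimensions*, LNM 2216, Springer (2018), Prop. 2.53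
  (proof sketch p. 65–66), Thm. 2.49. [Wendl2018]
* D. McDuff, D. Salamon, *J-holomorphic curves and symplectic topology*, 2nd ed. (2012),
  App. E. [McDuffSalamon2012]
* J. M. Lee, *Introduction to Smooth Manifolds*, 2nd ed. (2013), Thm. 4.5. [LeeSmoothManifolds2013]
-/

noncomputable section

open scoped Manifold ContDiff Topology ComplexConjugate
open Set Function Metric Filter Complex Literature.Geometry.Manifold

namespace Literature.Geometry.Symplectic


section Family

variable {X : Type} [TopologicalSpace X]
  [ChartedSpace (EuclideanSpace ℝ (Fin 4)) X] [IsManifold (𝓡 4) ∞ X]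
  {JX : AlmostComplexStructure (𝓡 4) ∞ X} {ε : ℝ} {U V : ℂ → ℂ → X}

/-! ### The parametrisation `Φ(a, z) = U a z` of the swept set is a diffeomorphism onto its image -/

/-- Finite dimension bookkeeping: `dim_ℝ (ℂ × ℂ) = 4 = dim_ℝ ℝ⁴`. [folklore] -/
theorem finrank_complex_prod : Module.finrank ℝ (ℂ × ℂ) = Module.finrank ℝ (EuclideanSpace ℝ (Fin 4)) := by
  rw [Module.finrank_prod, Complex.finrank_real_complex, finrank_euclideanSpace_fin]

omit [IsManifold (𝓡 4) ∞ X] in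
/-- An injective differential `ℂ × ℂ → T_y X` (`dim X = 4`) is bijective. [folklore] -/
theorem bijective_of_injective_mfderiv {Φ : ℂ × ℂ → X} {q : ℂ × ℂ}
    (h : Injective (mfderiv 𝓘(ℝ, ℂ × ℂ) (𝓡 4) Φ q)) :
    Bijective (mfderiv 𝓘(ℝ, ℂ × ℂ) (𝓡 4) Φ q) :=
  ⟨h, (LinearMap.injective_iff_surjective_of_finrank_eq_finrank finrank_complex_prod).1 h⟩

variable (hε : 0 < ε)
  (hleaf : ∀ a : ℂ, ‖a‖ < ε →
    ContMDiff 𝓘(ℝ, ℂ) (𝓡 4) ∞ (U a) ∧ ContMDiff 𝓘(ℝ, ℂ) (𝓡 4) ∞ (V a) ∧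
    (∀ z : ℂ, z ≠ 0 → V a z = U a z⁻¹) ∧
    IsJHolomorphic (𝓡 4) (fun y => JX y) (U a) ∧ IsJHolomorphic (𝓡 4) (fun y => JX y) (V a) ∧
    Injective (U a) ∧ (∀ z, Injective (mfderiv 𝓘(ℝ, ℂ) (𝓡 4) (U a) z)) ∧
    Injective (mfderiv 𝓘(ℝ, ℂ) (𝓡 4) (V a) 0) ∧ V a 0 ∉ range (U a))
  (hUs : ContMDiffOn 𝓘(ℝ, ℂ × ℂ) (𝓡 4) ∞ (fun q : ℂ × ℂ => U q.1 q.2) (ball 0 ε ×ˢ univ))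
  (hVs : ContMDiffOn 𝓘(ℝ, ℂ × ℂ) (𝓡 4) ∞ (fun q : ℂ × ℂ => V q.1 q.2) (ball 0 ε ×ˢ univ))
  (hdisj : ∀ a a' : ℂ, ‖a‖ < ε → ‖a'‖ < ε → a ≠ a' →
    Disjoint (range (U a) ∪ {V a 0}) (range (U a') ∪ {V a' 0}))
  (himm : ∀ q ∈ ball (0 : ℂ) ε ×ˢ (univ : Set ℂ),
    Injective (mfderiv 𝓘(ℝ, ℂ × ℂ) (𝓡 4) (fun q : ℂ × ℂ => U q.1 q.2) q) ∧
    Injective (mfderiv 𝓘(ℝ, ℂ × ℂ) (𝓡 4) (fun q : ℂ × ℂ => V q.1 q.2) q))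

omit [IsManifold (𝓡 4) ∞ X] in
/-- The parameter domain `B_ε × ℂ` is open. [folklore] -/
theorem isOpen_paramDomain (ε : ℝ) : IsOpen (ball (0 : ℂ) ε ×ˢ (univ : Set ℂ)) :=
  isOpen_ball.prod isOpen_univ

omit [IsManifold (𝓡 4) ∞ X] in
/-- Membership in the parameter domain. [folklore] -/
theorem mem_paramDomain {a z : ℂ} (ha : ‖a‖ < ε) : (a, z) ∈ ball (0 : ℂ) ε ×ˢ (univ : Set ℂ) :=
  ⟨by simpa using ha, mem_univ _⟩

include hdisj hleaf in
/-- **`Φ_U (a, z) = U a z` is injective on `B_ε × ℂ`**: distinct leaves are disjoint and each `U a`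
is injective. [folklore] -/
theorem injOn_phiU : InjOn (fun q : ℂ × ℂ => U q.1 q.2) (ball 0 ε ×ˢ univ) := by
  rintro ⟨a, z⟩ ⟨ha, -⟩ ⟨a', z'⟩ ⟨ha', -⟩ (h : U a z = U a' z')
  rw [mem_ball, dist_zero_right] at ha ha'
  have haa : a = a' := by
    by_contra hne
    exact Set.disjoint_left.1 (hdisj a a' ha ha' hne) (Or.inl ⟨z, rfl⟩) (Or.inl ⟨z', h.symm⟩)
  subst haa
  exact Prod.ext rfl ((hleaf a ha).2.2.2.2.2.1 h)

include hdisj hleaf in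
/-- **`Φ_V (a, w) = V a w` is injective on `B_ε × ℂ`.** [folklore] -/
theorem injOn_phiV : InjOn (fun q : ℂ × ℂ => V q.1 q.2) (ball 0 ε ×ˢ univ) := by
  rintro ⟨a, w⟩ ⟨ha, -⟩ ⟨a', w'⟩ ⟨ha', -⟩ (h : V a w = V a' w')
  rw [mem_ball, dist_zero_right] at ha ha'
  have hmem : ∀ {b : ℂ} (x : ℂ), ‖b‖ < ε → V b x ∈ range (U b) ∪ {V b 0} := fun {b} x hb => by
    by_cases hx : x = 0
    · subst hx; exact Or.inr rfl
    · exact Or.inl ⟨x⁻¹, ((hleaf b hb).2.2.1 x hx).symm⟩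
  have haa : a = a' := by
    by_contra hne
    exact Set.disjoint_left.1 (hdisj a a' ha ha' hne) (hmem w ha) (h ▸ hmem w' ha')
  subst haa
  obtain ⟨-, -, hVU, -, -, hinj, -, -, hnot⟩ := hleaf a ha
  refine Prod.ext rfl ?_
  by_cases hw : w = 0
  · by_cases hw' : w' = 0
    · rw [hw, hw']
    · subst hw
      rw [hVU w' hw'] at h
      exact absurd ⟨_, h.symm⟩ hnot
  · by_cases hw' : w' = 0
    · subst hw'
      rw [hVU w hw] at h
      exact absurd ⟨_, h⟩ hnot
    · rw [hVU w hw, hVU w' hw'] at h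
      exact inv_injective (hinj h)

include himm in
omit [IsManifold (𝓡 4) ∞ X] in
/-- The differential of `Φ_U` is bijective on the parameter domain. [folklore] -/
theorem bijective_mfderiv_phiU :
    ∀ q ∈ ball (0 : ℂ) ε ×ˢ (univ : Set ℂ),
      Bijective (mfderiv 𝓘(ℝ, ℂ × ℂ) (𝓡 4) (fun q : ℂ × ℂ => U q.1 q.2) q) :=
  fun q hq => bijective_of_injective_mfderiv (himm q hq).1

include himm in
omit [IsManifold (𝓡 4) ∞ X] in
/-- The differential of `Φ_V` is bijective on the parameter domain. [folklore] -/
theorem bijective_mfderiv_phiV :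
    ∀ q ∈ ball (0 : ℂ) ε ×ˢ (univ : Set ℂ),
      Bijective (mfderiv 𝓘(ℝ, ℂ × ℂ) (𝓡 4) (fun q : ℂ × ℂ => V q.1 q.2) q) :=
  fun q hq => bijective_of_injective_mfderiv (himm q hq).2

include hleaf in
/-- **The swept set is the union of the images of the two parametrisations**:
`⋃_{|a|<ε} (range (U a) ∪ {V a 0}) = Φ_U(B_ε × ℂ) ∪ Φ_V(B_ε × ℂ)`. [folklore] -/
theorem sweep_eq_image_union :
    (⋃ a ∈ ball (0 : ℂ) ε, (range (U a) ∪ {V a 0})) =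
      (fun q : ℂ × ℂ => U q.1 q.2) '' (ball 0 ε ×ˢ univ) ∪
        (fun q : ℂ × ℂ => V q.1 q.2) '' (ball 0 ε ×ˢ univ) := by
  ext y
  simp only [mem_iUnion, mem_ball, dist_zero_right, exists_prop, mem_union, mem_image, mem_prod,
    mem_univ, and_true, Prod.exists]
  constructor
  · rintro ⟨a, ha, (⟨z, rfl⟩ | rfl)⟩
    · exact Or.inl ⟨a, z, ha, rfl⟩
    · exact Or.inr ⟨a, 0, ha, rfl⟩
  · rintro (⟨a, z, ha, rfl⟩ | ⟨a, w, ha, rfl⟩)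
    · exact ⟨a, ha, Or.inl ⟨z, rfl⟩⟩
    · by_cases hw : w = 0
      · subst hw; exact ⟨a, ha, Or.inr rfl⟩
      · exact ⟨a, ha, Or.inl ⟨w⁻¹, ((hleaf a ha).2.2.1 w hw).symm⟩⟩

include hleaf hdisj in
/-- A point `V a w` lies in the image of `Φ_U` iff `w ≠ 0`; in particular `V a 0 ∉ Φ_U(B_ε × ℂ)`.
[folklore] -/
theorem V_zero_not_mem_image_phiU {a : ℂ} (ha : ‖a‖ < ε) :
    V a 0 ∉ (fun q : ℂ × ℂ => U q.1 q.2) '' (ball 0 ε ×ˢ univ) := by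
  rintro ⟨⟨a', z⟩, ⟨ha', -⟩, h⟩
  rw [mem_ball, dist_zero_right] at ha'
  change U a' z = V a 0 at h
  by_cases haa : a' = a
  · subst haa
    exact (hleaf a' ha).2.2.2.2.2.2.2.2 ⟨z, h⟩
  · exact Set.disjoint_left.1 (hdisj a' a ha' ha haa) (Or.inl ⟨z, rfl⟩) (h ▸ Or.inr rfl)

/-! ### The leaf function -/

open Classical in
/-- **The leaf function** of the family: on the swept set `⋃_{|a|<ε} (range (U a) ∪ {V a 0})` it
is the parameter `a` of the leaf through the point, read off through the inverse of
`Φ_U (a, z) = U a z` on its image and of `Φ_V (a, w) = V a w` elsewhere (junk outside the swept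
set). For the smooth `2`-dimensional family of embedded `J`-spheres of Wendl 2018, Prop. 2.53,
this is the projection of the local diffeomorphism `(a, z) ↦ u_a(z)` to the moduli space.
[cite: Wendl2018, Prop. 2.53] -/
def leafFunction (U V : ℂ → ℂ → X) (ε : ℝ) : X → ℂ := fun y =>
  if y ∈ (fun q : ℂ × ℂ => U q.1 q.2) '' (ball 0 ε ×ˢ univ) then
    (invFunOn (fun q : ℂ × ℂ => U q.1 q.2) (ball 0 ε ×ˢ univ) y).1
  else (invFunOn (fun q : ℂ × ℂ => V q.1 q.2) (ball 0 ε ×ˢ univ) y).1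

omit [TopologicalSpace X] [ChartedSpace (EuclideanSpace ℝ (Fin 4)) X] [IsManifold (𝓡 4) ∞ X] in
/-- On the image of `Φ_U` the leaf function is the first component of `Φ_U⁻¹`. [folklore] -/
theorem leafFunction_of_mem_image {y : X}
    (hy : y ∈ (fun q : ℂ × ℂ => U q.1 q.2) '' (ball 0 ε ×ˢ univ)) :
    leafFunction U V ε y = (invFunOn (fun q : ℂ × ℂ => U q.1 q.2) (ball 0 ε ×ˢ univ) y).1 := by
  simp only [leafFunction, if_pos hy]

omit [TopologicalSpace X] [ChartedSpace (EuclideanSpace ℝ (Fin 4)) X] [IsManifold (𝓡 4) ∞ X] in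
/-- Off the image of `Φ_U` the leaf function is the first component of `Φ_V⁻¹`. [folklore] -/
theorem leafFunction_of_not_mem_image {y : X}
    (hy : y ∉ (fun q : ℂ × ℂ => U q.1 q.2) '' (ball 0 ε ×ˢ univ)) :
    leafFunction U V ε y = (invFunOn (fun q : ℂ × ℂ => V q.1 q.2) (ball 0 ε ×ˢ univ) y).1 := by
  simp only [leafFunction, if_neg hy]

include hleaf hdisj in
/-- **The leaf function on the first charts**: `A (U a z) = a`. [cite: Wendl2018, Prop. 2.53] -/
theorem leafFunction_apply_U {a : ℂ} (ha : ‖a‖ < ε) (z : ℂ) : leafFunction U V ε (U a z) = a := by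
  have hq : (a, z) ∈ ball (0 : ℂ) ε ×ˢ (univ : Set ℂ) := mem_paramDomain ha
  have hy : U a z ∈ (fun q : ℂ × ℂ => U q.1 q.2) '' (ball 0 ε ×ˢ univ) := ⟨(a, z), hq, rfl⟩
  rw [leafFunction_of_mem_image hy]
  have := (injOn_phiU hleaf hdisj).leftInvOn_invFunOn hq
  exact congrArg Prod.fst this

include hleaf hdisj in
/-- **The leaf function is the first component of `Φ_V⁻¹` on the whole image of `Φ_V`** (the two
inverses agree where both are defined: a point of two leaves determines the leaf). [folklore] -/
theorem leafFunction_apply_V {a : ℂ} (ha : ‖a‖ < ε) (w : ℂ) : leafFunction U V ε (V a w) = a := by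
  by_cases hw : w = 0
  · subst hw
    rw [leafFunction_of_not_mem_image (V_zero_not_mem_image_phiU hleaf hdisj ha)]
    exact congrArg Prod.fst ((injOn_phiV hleaf hdisj).leftInvOn_invFunOn (mem_paramDomain ha))
  · rw [(hleaf a ha).2.2.1 w hw]
    exact leafFunction_apply_U hleaf hdisj ha _

include hleaf hdisj in
/-- On the image of `Φ_V` the leaf function agrees with the first component of `Φ_V⁻¹`.
[folklore] -/
theorem leafFunction_eqOn_image_V :
    EqOn (leafFunction U V ε)
      (fun y => (invFunOn (fun q : ℂ × ℂ => V q.1 q.2) (ball 0 ε ×ˢ univ) y).1)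
      ((fun q : ℂ × ℂ => V q.1 q.2) '' (ball 0 ε ×ˢ univ)) := by
  rintro _ ⟨⟨a, w⟩, hq, rfl⟩
  have ha : ‖a‖ < ε := by simpa using hq.1
  simp only
  rw [leafFunction_apply_V hleaf hdisj ha]
  exact (congrArg Prod.fst ((injOn_phiV hleaf hdisj).leftInvOn_invFunOn hq)).symm

omit [TopologicalSpace X] [ChartedSpace (EuclideanSpace ℝ (Fin 4)) X] [IsManifold (𝓡 4) ∞ X] in
/-- On the image of `Φ_U` the leaf function agrees with the first component of `Φ_U⁻¹`.
[folklore] -/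
theorem leafFunction_eqOn_image_U :
    EqOn (leafFunction U V ε)
      (fun y => (invFunOn (fun q : ℂ × ℂ => U q.1 q.2) (ball 0 ε ×ˢ univ) y).1)
      ((fun q : ℂ × ℂ => U q.1 q.2) '' (ball 0 ε ×ˢ univ)) :=
  fun _ hy => leafFunction_of_mem_image hy

include hleaf hdisj in
/-- **The leaf function reads the leaf**: a point of the swept set lies on the leaf of parameter
`A y`, and `|A y| < ε`. [cite: Wendl2018, Prop. 2.53] -/
theorem mem_leaf_leafFunction {y : X} (hy : y ∈ ⋃ a ∈ ball (0 : ℂ) ε, (range (U a) ∪ {V a 0})) :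
    ‖leafFunction U V ε y‖ < ε ∧
      y ∈ range (U (leafFunction U V ε y)) ∪ {V (leafFunction U V ε y) 0} := by
  simp only [mem_iUnion, mem_ball, dist_zero_right, exists_prop] at hy
  obtain ⟨a, ha, hy⟩ := hy
  rcases hy with ⟨z, rfl⟩ | rfl
  · rw [leafFunction_apply_U hleaf hdisj ha]
    exact ⟨ha, Or.inl ⟨z, rfl⟩⟩
  · rw [leafFunction_apply_V hleaf hdisj ha]
    exact ⟨ha, Or.inr rfl⟩

include hleaf hdisj in
/-- **Level sets of the leaf function are the leaves**: for `|a| < ε`,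
`{y ∈ sweep | A y = a} = range (U a) ∪ {V a 0}`. [cite: Wendl2018, Prop. 2.53] -/
theorem leafFunction_levelSet {a : ℂ} (ha : ‖a‖ < ε) :
    {y : X | y ∈ (⋃ a ∈ ball (0 : ℂ) ε, (range (U a) ∪ {V a 0})) ∧ leafFunction U V ε y = a} =
      range (U a) ∪ {V a 0} := by
  ext y
  constructor
  · rintro ⟨hy, rfl⟩
    exact (mem_leaf_leafFunction hleaf hdisj hy).2
  · intro hy
    refine ⟨mem_iUnion₂.2 ⟨a, by simpa using ha, hy⟩, ?_⟩
    rcases hy with ⟨z, rfl⟩ | rfl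
    · exact leafFunction_apply_U hleaf hdisj ha z
    · exact leafFunction_apply_V hleaf hdisj ha 0

/-! ### Smoothness and the differential of the leaf function -/

include hleaf hdisj hUs himm in
/-- The leaf function is `C^∞` on the image of `Φ_U`. [cite: Wendl2018, Prop. 2.53] -/
theorem contMDiffOn_leafFunction_image_U :
    ContMDiffOn (𝓡 4) 𝓘(ℝ, ℂ) ∞ (leafFunction U V ε)
      ((fun q : ℂ × ℂ => U q.1 q.2) '' (ball 0 ε ×ˢ univ)) := by
  have hG := contMDiffOn_invFunOn_of_bijective_mfderiv (I := 𝓘(ℝ, ℂ × ℂ)) (J := 𝓡 4)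
    (isOpen_paramDomain ε) hUs (injOn_phiU hleaf hdisj) (bijective_mfderiv_phiU himm)
  have hfst : ContMDiff 𝓘(ℝ, ℂ × ℂ) 𝓘(ℝ, ℂ) ∞ (Prod.fst : ℂ × ℂ → ℂ) :=
    contMDiff_iff_contDiff.2 contDiff_fst
  exact (hfst.comp_contMDiffOn hG).congr leafFunction_eqOn_image_U

include hleaf hdisj hVs himm in
/-- The leaf function is `C^∞` on the image of `Φ_V`. [cite: Wendl2018, Prop. 2.53] -/
theorem contMDiffOn_leafFunction_image_V :
    ContMDiffOn (𝓡 4) 𝓘(ℝ, ℂ) ∞ (leafFunction U V ε)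
      ((fun q : ℂ × ℂ => V q.1 q.2) '' (ball 0 ε ×ˢ univ)) := by
  have hG := contMDiffOn_invFunOn_of_bijective_mfderiv (I := 𝓘(ℝ, ℂ × ℂ)) (J := 𝓡 4)
    (isOpen_paramDomain ε) hVs (injOn_phiV hleaf hdisj) (bijective_mfderiv_phiV himm)
  have hfst : ContMDiff 𝓘(ℝ, ℂ × ℂ) 𝓘(ℝ, ℂ) ∞ (Prod.fst : ℂ × ℂ → ℂ) :=
    contMDiff_iff_contDiff.2 contDiff_fst
  exact (hfst.comp_contMDiffOn hG).congr (leafFunction_eqOn_image_V hleaf hdisj)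

include hUs himm in
/-- The image of `Φ_U` is open. [folklore] -/
theorem isOpen_image_U :
    IsOpen ((fun q : ℂ × ℂ => U q.1 q.2) '' (ball 0 ε ×ˢ univ)) :=
  isOpen_image_of_bijective_mfderiv (I := 𝓘(ℝ, ℂ × ℂ)) (J := 𝓡 4) (isOpen_paramDomain ε) hUs
    (bijective_mfderiv_phiU himm)

include hVs himm in
/-- The image of `Φ_V` is open. [folklore] -/
theorem isOpen_image_V :
    IsOpen ((fun q : ℂ × ℂ => V q.1 q.2) '' (ball 0 ε ×ˢ univ)) :=
  isOpen_image_of_bijective_mfderiv (I := 𝓘(ℝ, ℂ × ℂ)) (J := 𝓡 4) (isOpen_paramDomain ε) hVs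
    (bijective_mfderiv_phiV himm)

include hleaf hdisj hUs hVs himm in
/-- **The leaf function is `C^∞` on the swept set.** [cite: Wendl2018, Prop. 2.53] -/
theorem contMDiffOn_leafFunction :
    ContMDiffOn (𝓡 4) 𝓘(ℝ, ℂ) ∞ (leafFunction U V ε)
      (⋃ a ∈ ball (0 : ℂ) ε, (range (U a) ∪ {V a 0})) := by
  rw [sweep_eq_image_union hleaf]
  rintro y (hy | hy)
  · exact ((contMDiffOn_leafFunction_image_U hleaf hUs hdisj himm).contMDiffAt
      ((isOpen_image_U hUs himm).mem_nhds hy)).contMDiffWithinAt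
  · exact ((contMDiffOn_leafFunction_image_V hleaf hVs hdisj himm).contMDiffAt
      ((isOpen_image_V hVs himm).mem_nhds hy)).contMDiffWithinAt

include hleaf hUs hVs himm in
/-- **The swept set is open** (it is `Φ_U(B_ε × ℂ) ∪ Φ_V(B_ε × ℂ)`). [cite: Wendl2018, Prop. 2.53] -/
theorem isOpen_sweep :
    IsOpen (⋃ a ∈ ball (0 : ℂ) ε, (range (U a) ∪ {V a 0})) := by
  rw [sweep_eq_image_union hleaf]
  exact (isOpen_image_U hUs himm).union (isOpen_image_V hVs himm)

/-! ### The differential of the leaf function -/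

section Generic

variable {Φ : ℂ × ℂ → X} {A : X → ℂ} {q : ℂ × ℂ}

omit [IsManifold (𝓡 4) ∞ X] in
/-- **Chain rule for a left inverse component**: if `A (Φ q) = q.1` on the open parameter domain,
`Φ` is smooth there and `A` is smooth on the (open) image, then `dA_{Φ q} ∘ dΦ_q = pr₁`.
[folklore] -/
theorem mfderiv_comp_mfderiv_eq_fst (hΦ : ContMDiffOn 𝓘(ℝ, ℂ × ℂ) (𝓡 4) ∞ Φ (ball 0 ε ×ˢ univ))
    (hA : ContMDiffOn (𝓡 4) 𝓘(ℝ, ℂ) ∞ A (Φ '' (ball 0 ε ×ˢ univ)))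
    (hopen : IsOpen (Φ '' (ball 0 ε ×ˢ univ)))
    (hAΦ : ∀ q ∈ ball (0 : ℂ) ε ×ˢ (univ : Set ℂ), A (Φ q) = q.1)
    (hq : q ∈ ball (0 : ℂ) ε ×ˢ (univ : Set ℂ)) :
    (mfderiv (𝓡 4) 𝓘(ℝ, ℂ) A (Φ q)).comp (mfderiv 𝓘(ℝ, ℂ × ℂ) (𝓡 4) Φ q) =
      ContinuousLinearMap.fst ℝ ℂ ℂ := by
  have hAd : MDifferentiableAt (𝓡 4) 𝓘(ℝ, ℂ) A (Φ q) :=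
    (hA.contMDiffAt (hopen.mem_nhds ⟨q, hq, rfl⟩)).mdifferentiableAt (by simp)
  have hΦd : MDifferentiableAt 𝓘(ℝ, ℂ × ℂ) (𝓡 4) Φ q :=
    (hΦ.contMDiffAt ((isOpen_paramDomain ε).mem_nhds hq)).mdifferentiableAt (by simp)
  have hcomp := mfderiv_comp q hAd hΦd
  have heq : (A ∘ Φ) =ᶠ[𝓝 q] (Prod.fst : ℂ × ℂ → ℂ) :=
    Filter.eventuallyEq_of_mem ((isOpen_paramDomain ε).mem_nhds hq) fun q' hq' => hAΦ q' hq'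
  rw [← hcomp, heq.mfderiv_eq, mfderiv_eq_fderiv, fderiv_fst]

omit [IsManifold (𝓡 4) ∞ X] in
/-- The differential of a slice `z ↦ Φ (a, z)` is `dΦ_{(a,z)} (0, ·)`. [folklore] -/
theorem mfderiv_slice_apply (hΦ : ContMDiffOn 𝓘(ℝ, ℂ × ℂ) (𝓡 4) ∞ Φ (ball 0 ε ×ˢ univ))
    {a z : ℂ} (ha : ‖a‖ < ε) (ζ : ℂ) :
    mfderiv 𝓘(ℝ, ℂ) (𝓡 4) (fun z : ℂ => Φ (a, z)) z ζ =
      mfderiv 𝓘(ℝ, ℂ × ℂ) (𝓡 4) Φ (a, z) ((0 : ℂ), ζ) := by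
  have hΦd : MDifferentiableAt 𝓘(ℝ, ℂ × ℂ) (𝓡 4) Φ (a, z) :=
    (hΦ.contMDiffAt ((isOpen_paramDomain ε).mem_nhds (mem_paramDomain ha))).mdifferentiableAt
      (by simp)
  have h1 : HasMFDerivAt 𝓘(ℝ, ℂ) 𝓘(ℝ, ℂ × ℂ) (fun z : ℂ => (a, z)) z
      (ContinuousLinearMap.inr ℝ ℂ ℂ) :=
    (hasFDerivAt_prodMk_right (𝕜 := ℝ) a z).hasMFDerivAt
  have h2 := hΦd.hasMFDerivAt.comp z h1
  rw [show (fun z : ℂ => Φ (a, z)) = Φ ∘ fun z : ℂ => (a, z) from rfl, h2.mfderiv]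
  rfl

omit [IsManifold (𝓡 4) ∞ X] in
/-- **Kernel of `dA`**: with `dA_{Φ q} ∘ dΦ_q = pr₁` and `dΦ_q` onto, `dA_{Φ q} v = 0` iff `v` is
tangent to the slice, `v = dΦ_q (0, ζ)`. [folklore] -/
theorem mfderiv_apply_eq_zero_iff
    (hcomp : (mfderiv (𝓡 4) 𝓘(ℝ, ℂ) A (Φ q)).comp (mfderiv 𝓘(ℝ, ℂ × ℂ) (𝓡 4) Φ q) =
      ContinuousLinearMap.fst ℝ ℂ ℂ)
    (hsurj : Surjective (mfderiv 𝓘(ℝ, ℂ × ℂ) (𝓡 4) Φ q)) (v : TangentSpace (𝓡 4) (Φ q)) :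
    mfderiv (𝓡 4) 𝓘(ℝ, ℂ) A (Φ q) v = 0 ↔
      ∃ ζ : ℂ, v = mfderiv 𝓘(ℝ, ℂ × ℂ) (𝓡 4) Φ q ((0 : ℂ), ζ) := by
  have key : ∀ p : ℂ × ℂ, mfderiv (𝓡 4) 𝓘(ℝ, ℂ) A (Φ q) (mfderiv 𝓘(ℝ, ℂ × ℂ) (𝓡 4) Φ q p) = p.1 :=
    fun p => DFunLike.congr_fun hcomp p
  constructor
  · intro hv
    obtain ⟨⟨δa, δz⟩, rfl⟩ := hsurj v
    have h0 : δa = 0 := (key (δa, δz)).symm.trans hv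
    exact ⟨δz, by rw [h0]⟩
  · rintro ⟨ζ, rfl⟩
    exact key _

omit [IsManifold (𝓡 4) ∞ X] in
/-- **Surjectivity of `dA`** from `dA ∘ dΦ = pr₁`. [folklore] -/
theorem surjective_mfderiv_of_comp_eq_fst
    (hcomp : (mfderiv (𝓡 4) 𝓘(ℝ, ℂ) A (Φ q)).comp (mfderiv 𝓘(ℝ, ℂ × ℂ) (𝓡 4) Φ q) =
      ContinuousLinearMap.fst ℝ ℂ ℂ) :
    Surjective (mfderiv (𝓡 4) 𝓘(ℝ, ℂ) A (Φ q)) := fun c =>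
  ⟨mfderiv 𝓘(ℝ, ℂ × ℂ) (𝓡 4) Φ q (c, 0), DFunLike.congr_fun hcomp (c, 0)⟩

/-- **`J`-invariance of `ker dA`**: if moreover the slice `z ↦ Φ (a, z)` through `Φ q` is
`JX`-holomorphic, then `dA_{Φ q} v = 0` implies `dA_{Φ q} (J v) = 0`. [folklore] -/
theorem mfderiv_apply_J_eq_zero (hΦ : ContMDiffOn 𝓘(ℝ, ℂ × ℂ) (𝓡 4) ∞ Φ (ball 0 ε ×ˢ univ))
    {a z : ℂ} (ha : ‖a‖ < ε)
    (hcomp : (mfderiv (𝓡 4) 𝓘(ℝ, ℂ) A (Φ (a, z))).comp (mfderiv 𝓘(ℝ, ℂ × ℂ) (𝓡 4) Φ (a, z)) =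
      ContinuousLinearMap.fst ℝ ℂ ℂ)
    (hsurj : Surjective (mfderiv 𝓘(ℝ, ℂ × ℂ) (𝓡 4) Φ (a, z)))
    (hJ : IsJHolomorphic (𝓡 4) (fun y => JX y) (fun z : ℂ => Φ (a, z)))
    {v : TangentSpace (𝓡 4) (Φ (a, z))} (hv : mfderiv (𝓡 4) 𝓘(ℝ, ℂ) A (Φ (a, z)) v = 0) :
    mfderiv (𝓡 4) 𝓘(ℝ, ℂ) A (Φ (a, z)) (JX (Φ (a, z)) v) = 0 := by
  rw [mfderiv_apply_eq_zero_iff hcomp hsurj] at hv ⊢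
  obtain ⟨ζ, rfl⟩ := hv
  refine ⟨Complex.I * ζ, ?_⟩
  rw [← mfderiv_slice_apply hΦ ha, ← mfderiv_slice_apply hΦ ha]
  exact (hJ z ζ).symm

end Generic

include hleaf hdisj hUs himm in
/-- `dA ∘ dΦ_U = pr₁` on the parameter domain. [cite: Wendl2018, Prop. 2.53] -/
theorem mfderiv_leafFunction_comp_mfderiv_U {q : ℂ × ℂ} (hq : q ∈ ball (0 : ℂ) ε ×ˢ (univ : Set ℂ)) :
    (mfderiv (𝓡 4) 𝓘(ℝ, ℂ) (leafFunction U V ε) ((fun q : ℂ × ℂ => U q.1 q.2) q)).comp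
        (mfderiv 𝓘(ℝ, ℂ × ℂ) (𝓡 4) (fun q : ℂ × ℂ => U q.1 q.2) q) =
      ContinuousLinearMap.fst ℝ ℂ ℂ :=
  mfderiv_comp_mfderiv_eq_fst hUs (contMDiffOn_leafFunction_image_U hleaf hUs hdisj himm)
    (isOpen_image_U hUs himm) (fun q' hq' => leafFunction_apply_U hleaf hdisj (by simpa using hq'.1) _)
    hq

include hleaf hdisj hVs himm in
/-- `dA ∘ dΦ_V = pr₁` on the parameter domain. [cite: Wendl2018, Prop. 2.53] -/
theorem mfderiv_leafFunction_comp_mfderiv_V {q : ℂ × ℂ} (hq : q ∈ ball (0 : ℂ) ε ×ˢ (univ : Set ℂ)) :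
    (mfderiv (𝓡 4) 𝓘(ℝ, ℂ) (leafFunction U V ε) ((fun q : ℂ × ℂ => V q.1 q.2) q)).comp
        (mfderiv 𝓘(ℝ, ℂ × ℂ) (𝓡 4) (fun q : ℂ × ℂ => V q.1 q.2) q) =
      ContinuousLinearMap.fst ℝ ℂ ℂ :=
  mfderiv_comp_mfderiv_eq_fst hVs (contMDiffOn_leafFunction_image_V hleaf hVs hdisj himm)
    (isOpen_image_V hVs himm) (fun q' hq' => leafFunction_apply_V hleaf hdisj (by simpa using hq'.1) _)
    hq

include hleaf hdisj hUs hVs himm in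
/-- **The leaf function is a submersion on the swept set.** [cite: Wendl2018, Prop. 2.53] -/
theorem surjective_mfderiv_leafFunction {y : X}
    (hy : y ∈ ⋃ a ∈ ball (0 : ℂ) ε, (range (U a) ∪ {V a 0})) :
    Surjective (mfderiv (𝓡 4) 𝓘(ℝ, ℂ) (leafFunction U V ε) y) := by
  rw [sweep_eq_image_union hleaf] at hy
  rcases hy with ⟨q, hq, rfl⟩ | ⟨q, hq, rfl⟩
  · exact surjective_mfderiv_of_comp_eq_fst (Φ := fun q : ℂ × ℂ => U q.1 q.2)
      (mfderiv_leafFunction_comp_mfderiv_U hleaf hUs hdisj himm hq)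
  · exact surjective_mfderiv_of_comp_eq_fst (Φ := fun q : ℂ × ℂ => V q.1 q.2)
      (mfderiv_leafFunction_comp_mfderiv_V hleaf hVs hdisj himm hq)

include hleaf hdisj hUs hVs himm in
/-- **The kernel of `dA` is `J`-invariant** (it is the tangent plane of the `JX`-holomorphic leaf
through the point). [cite: Wendl2018, Prop. 2.53] -/
theorem mfderiv_leafFunction_J_eq_zero {y : X}
    (hy : y ∈ ⋃ a ∈ ball (0 : ℂ) ε, (range (U a) ∪ {V a 0})) {v : TangentSpace (𝓡 4) y}
    (hv : mfderiv (𝓡 4) 𝓘(ℝ, ℂ) (leafFunction U V ε) y v = 0) :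
    mfderiv (𝓡 4) 𝓘(ℝ, ℂ) (leafFunction U V ε) y (JX y v) = 0 := by
  rw [sweep_eq_image_union hleaf] at hy
  rcases hy with ⟨⟨a, z⟩, hq, rfl⟩ | ⟨⟨a, w⟩, hq, rfl⟩
  · have ha : ‖a‖ < ε := by simpa using hq.1
    exact mfderiv_apply_J_eq_zero (Φ := fun q : ℂ × ℂ => U q.1 q.2) hUs ha
      (mfderiv_leafFunction_comp_mfderiv_U hleaf hUs hdisj himm hq)
      (bijective_mfderiv_phiU himm _ hq).2 (hleaf a ha).2.2.2.1 hv
  · have ha : ‖a‖ < ε := by simpa using hq.1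
    exact mfderiv_apply_J_eq_zero (Φ := fun q : ℂ × ℂ => V q.1 q.2) hVs ha
      (mfderiv_leafFunction_comp_mfderiv_V hleaf hVs hdisj himm hq)
      (bijective_mfderiv_phiV himm _ hq).2 (hleaf a ha).2.2.2.2.1 hv

end Family

/-! ### The orientation sign of a leaf coordinate relative to `J` -/

section Chart

variable {X : Type} [TopologicalSpace X]
  [ChartedSpace (EuclideanSpace ℝ (Fin 4)) X] [IsManifold (𝓡 4) ∞ X]

omit [IsManifold (𝓡 4) ∞ X] in
/-- A function `C^∞` at `y₀` in the manifold sense has a `C^∞` chart expression at `φ y₀`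
(`contMDiffAt_iff`). [folklore] -/
theorem contDiffAt_comp_extChartAt_symm {A : X → ℂ} {y₀ : X}
    (hA : ContMDiffAt (𝓡 4) 𝓘(ℝ, ℂ) ∞ A y₀) :
    ContDiffAt ℝ ∞ (A ∘ (extChartAt (𝓡 4) y₀).symm) (extChartAt (𝓡 4) y₀ y₀) := by
  have h := (contMDiffAt_iff.1 hA).2
  simp only [extChartAt_model_space_eq_id, PartialEquiv.refl_coe, Function.id_comp,
    ModelWithCorners.Boundaryless.range_eq_univ, contDiffWithinAt_univ] at h
  exact h

/-- **The differential read in a fixed chart**: near the centre `y₀`, `dA_y = D(A ∘ φ⁻¹)(φ y) ∘ dφ_y`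
for the extended chart `φ` at `y₀` (chain rule; `A = (A ∘ φ⁻¹) ∘ φ` near `y`). [folklore] -/
theorem mfderiv_eq_fderiv_comp_mfderiv_extChartAt {A : X → ℂ} {y₀ y : X}
    (hy : y ∈ (extChartAt (𝓡 4) y₀).source)
    (hd : DifferentiableAt ℝ (A ∘ (extChartAt (𝓡 4) y₀).symm) (extChartAt (𝓡 4) y₀ y)) :
    mfderiv (𝓡 4) 𝓘(ℝ, ℂ) A y =
      (fderiv ℝ (A ∘ (extChartAt (𝓡 4) y₀).symm) (extChartAt (𝓡 4) y₀ y)).comp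
        (mfderiv (𝓡 4) 𝓘(ℝ, EuclideanSpace ℝ (Fin 4)) (extChartAt (𝓡 4) y₀) y) := by
  have heq : A =ᶠ[𝓝 y] (A ∘ (extChartAt (𝓡 4) y₀).symm) ∘ extChartAt (𝓡 4) y₀ :=
    Filter.eventuallyEq_of_mem (extChartAt_source_mem_nhds' hy) fun y' hy' => by
      simp only [Function.comp_apply, (extChartAt (𝓡 4) y₀).left_inv hy']
  rw [heq.mfderiv_eq]
  have hy' : y ∈ (chartAt (EuclideanSpace ℝ (Fin 4)) y₀).source := by rwa [← extChartAt_source (I := 𝓡 4)]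
  have hφ : MDifferentiableAt (𝓡 4) 𝓘(ℝ, EuclideanSpace ℝ (Fin 4)) (extChartAt (𝓡 4) y₀) y :=
    mdifferentiableAt_extChartAt hy'
  rw [mfderiv_comp y (hd.mdifferentiableAt) hφ, mfderiv_eq_fderiv]
  rfl

/-! ### The orientation sign of `dA` relative to `J` is locally constant -/

section Sign

variable (JX : AlmostComplexStructure (𝓡 4) ∞ X)

/-- Pointwise: the sign predicate is decided by any one vector off the kernel. [folklore] -/
theorem posAt_iff {A : X → ℂ} {y : X}
    (hker : ∀ v, mfderiv (𝓡 4) 𝓘(ℝ, ℂ) A y v = 0 → mfderiv (𝓡 4) 𝓘(ℝ, ℂ) A y (JX y v) = 0)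
    {v₀ : TangentSpace (𝓡 4) y} (hv₀ : mfderiv (𝓡 4) 𝓘(ℝ, ℂ) A y v₀ ≠ 0) :
    (∀ v, mfderiv (𝓡 4) 𝓘(ℝ, ℂ) A y v ≠ 0 →
        0 < ((show ℂ from mfderiv (𝓡 4) 𝓘(ℝ, ℂ) A y (JX y v)) *
          conj (show ℂ from mfderiv (𝓡 4) 𝓘(ℝ, ℂ) A y v)).im) ↔
      0 < ((show ℂ from mfderiv (𝓡 4) 𝓘(ℝ, ℂ) A y (JX y v₀)) *
        conj (show ℂ from mfderiv (𝓡 4) 𝓘(ℝ, ℂ) A y v₀)).im := by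
  dsimp only
  refine ⟨fun h => h v₀ hv₀, fun h v hv => ?_⟩
  set L : TangentSpace (𝓡 4) y →ₗ[ℝ] ℂ := (mfderiv (𝓡 4) 𝓘(ℝ, ℂ) A y).toLinearMap with hL
  set Jl : TangentSpace (𝓡 4) y →ₗ[ℝ] TangentSpace (𝓡 4) y :=
    (JX y : TangentSpace (𝓡 4) y →L[ℝ] TangentSpace (𝓡 4) y).toLinearMap with hJl
  have key := im_mul_conj_pos_iff Jl L (fun w => JX.map_map y w) (fun w hw => hker w hw) hv hv₀
  exact key.2 h

/-- **Local constancy of the orientation sign.** For `A` smooth on the open `W` with surjective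
differential whose kernel is `J`-invariant at every point of `W`, the sign of
`Im (dA(Jv) · conj (dA v))` (`v ∉ ker dA_y`) is locally constant in `y ∈ W`: in the chart at `y₀`
it is the sign of a continuous non-vanishing function of `y`. [folklore] -/
theorem eventually_posAt_iff {A : X → ℂ} {W : Set X} (hW : IsOpen W)
    (hA : ContMDiffOn (𝓡 4) 𝓘(ℝ, ℂ) ∞ A W)
    (hsurj : ∀ y ∈ W, Surjective (mfderiv (𝓡 4) 𝓘(ℝ, ℂ) A y))
    (hker : ∀ y ∈ W, ∀ v, mfderiv (𝓡 4) 𝓘(ℝ, ℂ) A y v = 0 →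
      mfderiv (𝓡 4) 𝓘(ℝ, ℂ) A y (JX y v) = 0)
    {y₀ : X} (hy₀ : y₀ ∈ W) :
    ∀ᶠ y in 𝓝 y₀,
      ((∀ v, mfderiv (𝓡 4) 𝓘(ℝ, ℂ) A y v ≠ 0 →
          0 < ((show ℂ from mfderiv (𝓡 4) 𝓘(ℝ, ℂ) A y (JX y v)) * conj (show ℂ from mfderiv (𝓡 4) 𝓘(ℝ, ℂ) A y v)).im) ↔
        (∀ v, mfderiv (𝓡 4) 𝓘(ℝ, ℂ) A y₀ v ≠ 0 →
          0 < ((show ℂ from mfderiv (𝓡 4) 𝓘(ℝ, ℂ) A y₀ (JX y₀ v)) *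
            conj (show ℂ from mfderiv (𝓡 4) 𝓘(ℝ, ℂ) A y₀ v)).im)) := by
  dsimp only
  set φ := extChartAt (𝓡 4) y₀ with hφ
  set Ah : EuclideanSpace ℝ (Fin 4) → ℂ := A ∘ φ.symm with hAh
  have hAy₀ : ContMDiffAt (𝓡 4) 𝓘(ℝ, ℂ) ∞ A y₀ := hA.contMDiffAt (hW.mem_nhds hy₀)
  have hÂ : ContDiffAt ℝ ∞ Ah (φ y₀) := contDiffAt_comp_extChartAt_symm hAy₀
  have hÂ1 : ContDiffAt ℝ 1 Ah (φ y₀) := hÂ.of_le (by exact_mod_cast le_top)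
  have hdiff : ∀ᶠ x in 𝓝 (φ y₀), DifferentiableAt ℝ Ah x :=
    (hÂ1.eventually (by simp)).mono fun x hx => hx.differentiableAt one_ne_zero
  have hdiff' : ∀ᶠ y in 𝓝 y₀, DifferentiableAt ℝ Ah (φ y) :=
    (continuousAt_extChartAt (I := 𝓡 4) y₀).eventually hdiff
  have hsrc : ∀ᶠ y in 𝓝 y₀, y ∈ φ.source := extChartAt_source_mem_nhds (I := 𝓡 4) y₀
  have hWn : ∀ᶠ y in 𝓝 y₀, y ∈ W := hW.mem_nhds hy₀
  -- the frame expression of `J` in the chart at `y₀`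
  set Jin : X → EuclideanSpace ℝ (Fin 4) →L[ℝ] EuclideanSpace ℝ (Fin 4) :=
    inTangentCoordinates (𝓡 4) (𝓡 4) (id : X → X) id
      (fun x => (JX x : TangentSpace (𝓡 4) x →L[ℝ] TangentSpace (𝓡 4) x)) y₀ with hJin
  have hJc : ContinuousAt Jin y₀ := (JX.contMDiffAt_inTangentCoordinates y₀).continuousAt
  -- a vector `e` with `dA_{y₀} (B e) ≠ 0`
  obtain ⟨w, hw⟩ := hsurj y₀ hy₀ (1 : ℂ)
  set e : EuclideanSpace ℝ (Fin 4) :=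
    mfderiv (𝓡 4) 𝓘(ℝ, EuclideanSpace ℝ (Fin 4)) φ y₀ w with he
  -- the continuous function
  set F : X → ℂ := fun y => fderiv ℝ Ah (φ y) (Jin y e) * conj (fderiv ℝ Ah (φ y) e) with hF
  have hc1 : ContinuousAt (fun y => fderiv ℝ Ah (φ y)) y₀ :=
    ContinuousAt.comp (f := φ) (g := fderiv ℝ Ah) (hÂ.continuousAt_fderiv (by simp))
      (continuousAt_extChartAt (I := 𝓡 4) y₀)
  have hFc : ContinuousAt F y₀ :=
    (hc1.clm_apply (hJc.clm_apply continuousAt_const)).mul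
      (Complex.continuous_conj.continuousAt.comp (hc1.clm_apply continuousAt_const))
  -- the key identities at points near `y₀`
  have key : ∀ y, y ∈ φ.source → DifferentiableAt ℝ Ah (φ y) →
      mfderiv (𝓡 4) 𝓘(ℝ, ℂ) A y
          (mfderivWithin 𝓘(ℝ, EuclideanSpace ℝ (Fin 4)) (𝓡 4) φ.symm (range (𝓡 4)) (φ y) e) =
        fderiv ℝ Ah (φ y) e ∧
      mfderiv (𝓡 4) 𝓘(ℝ, ℂ) A y (JX y
          (mfderivWithin 𝓘(ℝ, EuclideanSpace ℝ (Fin 4)) (𝓡 4) φ.symm (range (𝓡 4)) (φ y) e)) =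
        fderiv ℝ Ah (φ y) (Jin y e) := by
    intro y hy hd
    have hy' : y ∈ (chartAt (EuclideanSpace ℝ (Fin 4)) y₀).source := by
      rwa [← extChartAt_source (I := 𝓡 4)]
    have h1 := mfderiv_eq_fderiv_comp_mfderiv_extChartAt hy hd
    have h2 := mfderiv_extChartAt_comp_mfderivWithin_extChartAt_symm' (I := 𝓡 4) hy
    have h3 := inTangentCoordinates_eq_mfderiv_comp (I := 𝓡 4) (I' := 𝓡 4) (f := (id : X → X))
      (g := (id : X → X))
      (ϕ := fun x => (JX x : TangentSpace (𝓡 4) x →L[ℝ] TangentSpace (𝓡 4) x)) (x₀ := y₀)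
      (x := y) hy' hy'
    constructor
    · rw [h1]
      exact congrArg (fderiv ℝ Ah (φ y)) (DFunLike.congr_fun h2 e)
    · rw [h1]
      exact congrArg (fderiv ℝ Ah (φ y)) (DFunLike.congr_fun h3 e).symm
  -- at `y₀`
  have hsrc₀ : y₀ ∈ φ.source := mem_extChartAt_source (I := 𝓡 4) y₀
  have hd₀ : DifferentiableAt ℝ Ah (φ y₀) := hÂ.differentiableAt (by simp)
  have hBe : mfderivWithin 𝓘(ℝ, EuclideanSpace ℝ (Fin 4)) (𝓡 4) φ.symm (range (𝓡 4)) (φ y₀) e =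
      w := DFunLike.congr_fun (mfderivWithin_extChartAt_symm_comp_mfderiv_extChartAt' (I := 𝓡 4) hsrc₀) w
  obtain ⟨k1, k2⟩ := key y₀ hsrc₀ hd₀
  rw [hBe] at k1 k2
  have hF₀ : F y₀ = (show ℂ from mfderiv (𝓡 4) 𝓘(ℝ, ℂ) A y₀ (JX y₀ w)) *
      conj (show ℂ from mfderiv (𝓡 4) 𝓘(ℝ, ℂ) A y₀ w) := by
    dsimp only
    rw [hF, k1, k2]
  have hw0 : mfderiv (𝓡 4) 𝓘(ℝ, ℂ) A y₀ w ≠ 0 := fun h0 =>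
    one_ne_zero (α := ℂ) (hw.symm.trans h0)
  have hF₀ne : (F y₀).im ≠ 0 := by
    rw [hF₀]
    set L : TangentSpace (𝓡 4) y₀ →ₗ[ℝ] ℂ := (mfderiv (𝓡 4) 𝓘(ℝ, ℂ) A y₀).toLinearMap with hL
    set Jl : TangentSpace (𝓡 4) y₀ →ₗ[ℝ] TangentSpace (𝓡 4) y₀ :=
      (JX y₀ : TangentSpace (𝓡 4) y₀ →L[ℝ] TangentSpace (𝓡 4) y₀).toLinearMap with hJl
    exact im_mul_conj_ne_zero Jl L (fun w => JX.map_map y₀ w) (fun w hw => hker y₀ hy₀ w hw) hw0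
  -- the sign of `Im F` persists near `y₀`
  have hsign : ∀ᶠ y in 𝓝 y₀, (0 < (F y).im ↔ 0 < (F y₀).im) ∧ (F y).im ≠ 0 := by
    have hFi : ContinuousAt (fun y => (F y).im) y₀ := Complex.continuous_im.continuousAt.comp hFc
    rcases lt_or_gt_of_ne hF₀ne with h | h
    · filter_upwards [hFi.eventually (gt_mem_nhds h)] with y hy
      exact ⟨⟨fun h' => absurd h' (not_lt.2 hy.le), fun h' => absurd h' (not_lt.2 h.le)⟩, hy.ne⟩
    · filter_upwards [hFi.eventually (lt_mem_nhds h)] with y hy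
      exact ⟨⟨fun _ => h, fun _ => hy⟩, hy.ne'⟩
  filter_upwards [hdiff', hsrc, hWn, hsign] with y hd hy hyW ⟨hs, hne⟩
  obtain ⟨e1, e2⟩ := key y hy hd
  set v : TangentSpace (𝓡 4) y :=
    mfderivWithin 𝓘(ℝ, EuclideanSpace ℝ (Fin 4)) (𝓡 4) φ.symm (range (𝓡 4)) (φ y) e with hv
  have hFy : F y = (show ℂ from mfderiv (𝓡 4) 𝓘(ℝ, ℂ) A y (JX y v)) *
      conj (show ℂ from mfderiv (𝓡 4) 𝓘(ℝ, ℂ) A y v) := by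
    dsimp only
    rw [hF, e1, e2]
  have hfe : fderiv ℝ Ah (φ y) e ≠ 0 := by
    intro h0
    apply hne
    simp only [hF, h0, map_zero, mul_zero, Complex.zero_im]
  have hv0 : mfderiv (𝓡 4) 𝓘(ℝ, ℂ) A y v ≠ 0 := by
    rw [e1]
    exact hfe
  rw [posAt_iff JX (hker y hyW) hv0, posAt_iff JX (hker y₀ hy₀) hw0, ← hFy, ← hF₀]
  exact hs

/-- **The orientation sign is constant on a preconnected open set.** [folklore] -/
theorem posAt_iff_posAt_of_isPreconnected {A : X → ℂ} {W : Set X} (hW : IsOpen W)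
    (hWc : IsPreconnected W) (hA : ContMDiffOn (𝓡 4) 𝓘(ℝ, ℂ) ∞ A W)
    (hsurj : ∀ y ∈ W, Surjective (mfderiv (𝓡 4) 𝓘(ℝ, ℂ) A y))
    (hker : ∀ y ∈ W, ∀ v, mfderiv (𝓡 4) 𝓘(ℝ, ℂ) A y v = 0 →
      mfderiv (𝓡 4) 𝓘(ℝ, ℂ) A y (JX y v) = 0)
    {y y' : X} (hy : y ∈ W) (hy' : y' ∈ W) :
    (∀ v, mfderiv (𝓡 4) 𝓘(ℝ, ℂ) A y v ≠ 0 →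
        0 < ((show ℂ from mfderiv (𝓡 4) 𝓘(ℝ, ℂ) A y (JX y v)) *
          conj (show ℂ from mfderiv (𝓡 4) 𝓘(ℝ, ℂ) A y v)).im) ↔
      (∀ v, mfderiv (𝓡 4) 𝓘(ℝ, ℂ) A y' v ≠ 0 →
        0 < ((show ℂ from mfderiv (𝓡 4) 𝓘(ℝ, ℂ) A y' (JX y' v)) *
          conj (show ℂ from mfderiv (𝓡 4) 𝓘(ℝ, ℂ) A y' v)).im) := by
  dsimp only
  -- the sign predicate
  set P : X → Prop := fun z => ∀ v, mfderiv (𝓡 4) 𝓘(ℝ, ℂ) A z v ≠ 0 →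
    0 < ((show ℂ from mfderiv (𝓡 4) 𝓘(ℝ, ℂ) A z (JX z v)) *
      conj (show ℂ from mfderiv (𝓡 4) 𝓘(ℝ, ℂ) A z v)).im with hP
  have hloc : ∀ z ∈ W, ∀ᶠ x in 𝓝 z, (P x ↔ P z) := fun z hz =>
    eventually_posAt_iff JX hW hA hsurj hker hz
  set Op : Set X := {z | ∀ᶠ x in 𝓝 z, x ∈ W → P x} with hOp
  set Om : Set X := {z | ∀ᶠ x in 𝓝 z, x ∈ W → ¬ P x} with hOm
  have hOpo : IsOpen Op := isOpen_setOf_eventually_nhds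
  have hOmo : IsOpen Om := isOpen_setOf_eventually_nhds
  have hcov : W ⊆ Op ∪ Om := fun z hz => by
    by_cases hPz : P z
    · exact Or.inl ((hloc z hz).mono fun x hx _ => hx.2 hPz)
    · exact Or.inr ((hloc z hz).mono fun x hx _ hPx => hPz (hx.1 hPx))
  have hdis : ∀ z ∈ W, z ∈ Op → z ∈ Om → False := fun z hz h1 h2 =>
    (h2.self_of_nhds hz) (h1.self_of_nhds hz)
  show P y ↔ P y'
  constructor
  · intro hPy
    by_contra hPy'
    have hyO : y ∈ Op := (hloc y hy).mono fun x hx _ => hx.2 hPy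
    have hy'O : y' ∈ Om := (hloc y' hy').mono fun x hx _ hPx => hPy' (hx.1 hPx)
    obtain ⟨z, hzW, hz1, hz2⟩ := hWc Op Om hOpo hOmo hcov ⟨y, hy, hyO⟩ ⟨y', hy', hy'O⟩
    exact hdis z hzW hz1 hz2
  · intro hPy'
    by_contra hPy
    have hy'O : y' ∈ Op := (hloc y' hy').mono fun x hx _ => hx.2 hPy'
    have hyO : y ∈ Om := (hloc y hy).mono fun x hx _ hPx => hPy (hx.1 hPx)
    obtain ⟨z, hzW, hz1, hz2⟩ := hWc Op Om hOpo hOmo hcov ⟨y', hy', hy'O⟩ ⟨y, hy, hyO⟩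
    exact hdis z hzW hz1 hz2

end Sign

end Chart

/-! ### Post-composition with a real-linear automorphism of `ℂ` -/

section PostCompose

variable {X : Type} [TopologicalSpace X] [ChartedSpace (EuclideanSpace ℝ (Fin 4)) X]

/-- The derivative of `x ↦ α (x - c) + β conj (x - c)` is the real-linear map
`z ↦ α z + β z̄`. [folklore] -/
theorem hasFDerivAt_mul_add_mul_conj (α β c x : ℂ) :
    HasFDerivAt (fun x : ℂ => α * (x - c) + β * conj (x - c))
      (α • ContinuousLinearMap.id ℝ ℂ +
        β • (Complex.conjCLE : ℂ ≃L[ℝ] ℂ).toContinuousLinearMap) x := by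
  have h1 : HasFDerivAt (fun x : ℂ => x - c) (ContinuousLinearMap.id ℝ ℂ) x :=
    (hasFDerivAt_id (𝕜 := ℝ) x).sub_const c
  have h2 : HasFDerivAt (fun x : ℂ => conj (x - c))
      ((Complex.conjCLE : ℂ ≃L[ℝ] ℂ).toContinuousLinearMap) x := by
    have := ((Complex.conjCLE : ℂ ≃L[ℝ] ℂ).toContinuousLinearMap.hasFDerivAt).comp x h1
    rw [ContinuousLinearMap.comp_id] at this
    exact this
  exact (h1.const_mul α).add (h2.const_mul β)

/-- Evaluation of the real-linear map `α • id + β • conj`. [folklore] -/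
theorem smul_id_add_smul_conj_apply (α β z : ℂ) :
    (α • ContinuousLinearMap.id ℝ ℂ + β • (Complex.conjCLE : ℂ ≃L[ℝ] ℂ).toContinuousLinearMap) z =
      α * z + β * conj z := by
  simp [smul_eq_mul]

/-- `x ↦ α (x - c) + β conj (x - c)` is `C^∞` (as a real map). [folklore] -/
theorem contDiff_mul_add_mul_conj (α β c : ℂ) :
    ContDiff ℝ ∞ (fun x : ℂ => α * (x - c) + β * conj (x - c)) :=
  (contDiff_const.mul (contDiff_id.sub contDiff_const)).add
    (contDiff_const.mul (Complex.conjCLE.contDiff.comp (contDiff_id.sub contDiff_const)))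

variable {A : X → ℂ} {W : Set X}

/-- **Smoothness of the post-composed coordinate** `π = α (A - c) + β conj (A - c)` on `W`.
[folklore] -/
theorem contMDiffOn_postCompose (hA : ContMDiffOn (𝓡 4) 𝓘(ℝ, ℂ) ∞ A W) (α β c : ℂ) :
    ContMDiffOn (𝓡 4) 𝓘(ℝ, ℂ) ∞ (fun y => α * (A y - c) + β * conj (A y - c)) W :=
  (contMDiff_iff_contDiff.2 (contDiff_mul_add_mul_conj α β c)).comp_contMDiffOn hA

/-- **Differential of the post-composed coordinate**: `dπ_y = M ∘ dA_y` with
`M z = α z + β z̄`. [folklore] -/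
theorem mfderiv_postCompose_eq {y : X} (hAy : MDifferentiableAt (𝓡 4) 𝓘(ℝ, ℂ) A y)
    (α β c : ℂ) :
    mfderiv (𝓡 4) 𝓘(ℝ, ℂ) (fun y => α * (A y - c) + β * conj (A y - c)) y =
      (α • ContinuousLinearMap.id ℝ ℂ +
        β • (Complex.conjCLE : ℂ ≃L[ℝ] ℂ).toContinuousLinearMap).comp
        (mfderiv (𝓡 4) 𝓘(ℝ, ℂ) A y) := by
  have hg := (hasFDerivAt_mul_add_mul_conj α β c (A y)).hasMFDerivAt
  have h := hg.comp y hAy.hasMFDerivAt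
  exact h.mfderiv

/-- The differential of the post-composed coordinate on vectors:
`dπ_y v = α dA_y v + β conj (dA_y v)`. [folklore] -/
theorem mfderiv_postCompose_apply {y : X} (hAy : MDifferentiableAt (𝓡 4) 𝓘(ℝ, ℂ) A y)
    (α β c : ℂ) (v : TangentSpace (𝓡 4) y) :
    mfderiv (𝓡 4) 𝓘(ℝ, ℂ) (fun y => α * (A y - c) + β * conj (A y - c)) y v =
      α * (show ℂ from mfderiv (𝓡 4) 𝓘(ℝ, ℂ) A y v) +
        β * conj (show ℂ from mfderiv (𝓡 4) 𝓘(ℝ, ℂ) A y v) := by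
  dsimp only
  rw [mfderiv_postCompose_eq hAy]
  exact smul_id_add_smul_conj_apply α β _

/-- **The post-composed coordinate is a submersion** where `A` is, when `|α| ≠ |β|`. [folklore] -/
theorem surjective_mfderiv_postCompose {y : X} (hAy : MDifferentiableAt (𝓡 4) 𝓘(ℝ, ℂ) A y)
    (hsurj : Surjective (mfderiv (𝓡 4) 𝓘(ℝ, ℂ) A y)) {α β : ℂ} (h : ‖α‖ ≠ ‖β‖) (c : ℂ) :
    Surjective (mfderiv (𝓡 4) 𝓘(ℝ, ℂ) (fun y => α * (A y - c) + β * conj (A y - c)) y) := by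
  intro z
  obtain ⟨x, hx⟩ := (bijective_mul_add_mul_conj h).2 z
  obtain ⟨v, hv⟩ := hsurj x
  refine ⟨v, ?_⟩
  rw [mfderiv_postCompose_apply hAy]
  dsimp only
  rw [hv]
  exact hx

omit [TopologicalSpace X] [ChartedSpace (EuclideanSpace ℝ (Fin 4)) X] in
/-- **Zero set of the post-composed coordinate**: for `|α| ≠ |β|`,
`α (A y - c) + β conj (A y - c) = 0 ↔ A y = c`. [folklore] -/
theorem postCompose_eq_zero_iff {α β : ℂ} (h : ‖α‖ ≠ ‖β‖) (c : ℂ) (y : X) :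
    α * (A y - c) + β * conj (A y - c) = 0 ↔ A y = c := by
  constructor
  · intro h0
    have h00 : α * (0 : ℂ) + β * conj (0 : ℂ) = 0 := by simp
    have := (bijective_mul_add_mul_conj h).1 (h0.trans h00.symm)
    exact sub_eq_zero.1 this
  · intro hc
    simp [hc]

end PostCompose

/-! ### The leaf coordinate package at a point of the swept set -/

section Package

variable {X : Type} [TopologicalSpace X] [T2Space X]
  [ChartedSpace (EuclideanSpace ℝ (Fin 4)) X] [IsManifold (𝓡 4) ∞ X]
  {JX : AlmostComplexStructure (𝓡 4) ∞ X} {ε : ℝ} {U V : ℂ → ℂ → X}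

variable (hε : 0 < ε)
  (hleaf : ∀ a : ℂ, ‖a‖ < ε →
    ContMDiff 𝓘(ℝ, ℂ) (𝓡 4) ∞ (U a) ∧ ContMDiff 𝓘(ℝ, ℂ) (𝓡 4) ∞ (V a) ∧
    (∀ z : ℂ, z ≠ 0 → V a z = U a z⁻¹) ∧
    IsJHolomorphic (𝓡 4) (fun y => JX y) (U a) ∧ IsJHolomorphic (𝓡 4) (fun y => JX y) (V a) ∧
    Injective (U a) ∧ (∀ z, Injective (mfderiv 𝓘(ℝ, ℂ) (𝓡 4) (U a) z)) ∧
    Injective (mfderiv 𝓘(ℝ, ℂ) (𝓡 4) (V a) 0) ∧ V a 0 ∉ range (U a))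
  (hUs : ContMDiffOn 𝓘(ℝ, ℂ × ℂ) (𝓡 4) ∞ (fun q : ℂ × ℂ => U q.1 q.2) (ball 0 ε ×ˢ univ))
  (hVs : ContMDiffOn 𝓘(ℝ, ℂ × ℂ) (𝓡 4) ∞ (fun q : ℂ × ℂ => V q.1 q.2) (ball 0 ε ×ˢ univ))
  (hdisj : ∀ a a' : ℂ, ‖a‖ < ε → ‖a'‖ < ε → a ≠ a' →
    Disjoint (range (U a) ∪ {V a 0}) (range (U a') ∪ {V a' 0}))
  (himm : ∀ q ∈ ball (0 : ℂ) ε ×ˢ (univ : Set ℂ),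
    Injective (mfderiv 𝓘(ℝ, ℂ × ℂ) (𝓡 4) (fun q : ℂ × ℂ => U q.1 q.2) q) ∧
    Injective (mfderiv 𝓘(ℝ, ℂ × ℂ) (𝓡 4) (fun q : ℂ × ℂ => V q.1 q.2) q))

include hε hleaf hUs hVs in
omit [T2Space X] in
/-- **The swept set is preconnected** (union of the two connected images, meeting at `U 0 1 = V 0 1`).
[folklore] -/
theorem isPreconnected_sweep :
    IsPreconnected (⋃ a ∈ ball (0 : ℂ) ε, (range (U a) ∪ {V a 0})) := by
  rw [sweep_eq_image_union hleaf]
  have hs : IsPreconnected (ball (0 : ℂ) ε ×ˢ (univ : Set ℂ)) :=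
    (convex_ball (0 : ℂ) ε).isPreconnected.prod isPreconnected_univ
  have h0 : ‖(0 : ℂ)‖ < ε := by simpa using hε
  have hU01 : U 0 1 ∈ (fun q : ℂ × ℂ => U q.1 q.2) '' (ball 0 ε ×ˢ univ) :=
    ⟨(0, 1), mem_paramDomain h0, rfl⟩
  have hV01 : U 0 1 ∈ (fun q : ℂ × ℂ => V q.1 q.2) '' (ball 0 ε ×ˢ univ) := by
    refine ⟨(0, 1), mem_paramDomain h0, ?_⟩
    have h := (hleaf 0 h0).2.2.1 1 one_ne_zero
    rw [inv_one] at h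
    exact h
  exact IsPreconnected.union (U 0 1) hU01 hV01 (hs.image _ hUs.continuousOn)
    (hs.image _ hVs.continuousOn)

include hε hleaf hdisj hUs hVs himm in
omit [T2Space X] in
/-- **The orientation sign of the leaf function is the same at all points of the swept set**:
for `y, y'` swept and `v ∉ ker dA_y`, `v' ∉ ker dA_{y'}`, the signs of
`Im (dA(Jv) · conj (dA v))` agree. [folklore] -/
theorem leafFunction_sign_const {y y' : X}
    (hy : y ∈ ⋃ a ∈ ball (0 : ℂ) ε, (range (U a) ∪ {V a 0}))
    (hy' : y' ∈ ⋃ a ∈ ball (0 : ℂ) ε, (range (U a) ∪ {V a 0}))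
    {v : TangentSpace (𝓡 4) y} {v' : TangentSpace (𝓡 4) y'}
    (hv : mfderiv (𝓡 4) 𝓘(ℝ, ℂ) (leafFunction U V ε) y v ≠ 0)
    (hv' : mfderiv (𝓡 4) 𝓘(ℝ, ℂ) (leafFunction U V ε) y' v' ≠ 0) :
    0 < ((show ℂ from mfderiv (𝓡 4) 𝓘(ℝ, ℂ) (leafFunction U V ε) y (JX y v)) *
        conj (show ℂ from mfderiv (𝓡 4) 𝓘(ℝ, ℂ) (leafFunction U V ε) y v)).im ↔
      0 < ((show ℂ from mfderiv (𝓡 4) 𝓘(ℝ, ℂ) (leafFunction U V ε) y' (JX y' v')) *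
        conj (show ℂ from mfderiv (𝓡 4) 𝓘(ℝ, ℂ) (leafFunction U V ε) y' v')).im := by
  have hker : ∀ z ∈ (⋃ a ∈ ball (0 : ℂ) ε, (range (U a) ∪ {V a 0})), ∀ w,
      mfderiv (𝓡 4) 𝓘(ℝ, ℂ) (leafFunction U V ε) z w = 0 →
        mfderiv (𝓡 4) 𝓘(ℝ, ℂ) (leafFunction U V ε) z (JX z w) = 0 :=
    fun z hz w hw => mfderiv_leafFunction_J_eq_zero hleaf hUs hVs hdisj himm hz hw
  have hglob := posAt_iff_posAt_of_isPreconnected JX (isOpen_sweep hleaf hUs hVs himm)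
    (isPreconnected_sweep hε hleaf hUs hVs) (contMDiffOn_leafFunction hleaf hUs hVs hdisj himm)
    (fun z hz => surjective_mfderiv_leafFunction hleaf hUs hVs hdisj himm hz) hker hy hy'
  rw [posAt_iff JX (hker y hy) hv, posAt_iff JX (hker y' hy') hv'] at hglob
  exact hglob

include hleaf hdisj hUs hVs himm in
/-- **The leaf coordinate package at a point** (the form consumed by the local positivity of
intersections statement `positivityOfIntersections_leafCoordinate`). For `|a₀| < ε` and
`p` on the leaf of parameter `a₀` there are: a regular `JX`-holomorphic local parametrisation
`G` of the leaf with `G 0 = p`, and `α, β ∈ ℂ` with `|α| ≠ |β|`, such that the coordinate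
`π = α (A - a₀) + β conj (A - a₀)` (`A` the leaf function) has COMPLEX LINEAR differential at
`p`, cuts out exactly `G(V')` near `p` inside the swept set, and `|β| < |α|` (orientation
preserved, winding numbers of `π ∘ γ` and `(A - a₀) ∘ γ` agree) iff the orientation sign of
`dA_p` is positive. [cite: Wendl2018, Prop. 2.53] [cite: McDuffSalamon2012, App. E] -/
theorem exists_leafCoordinateAt {a₀ : ℂ} (ha₀ : ‖a₀‖ < ε) {p : X}
    (hp : p ∈ range (U a₀) ∪ {V a₀ 0}) :
    ∃ (G : ℂ → X) (α β : ℂ),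
      ContMDiff 𝓘(ℝ, ℂ) (𝓡 4) ∞ G ∧ IsJHolomorphic (𝓡 4) (fun y => JX y) G ∧ G 0 = p ∧
      Injective (mfderiv 𝓘(ℝ, ℂ) (𝓡 4) G 0) ∧ range G ⊆ range (U a₀) ∪ {V a₀ 0} ∧
      ‖α‖ ≠ ‖β‖ ∧
      (∀ v : TangentSpace (𝓡 4) p,
        (show ℂ from mfderiv (𝓡 4) 𝓘(ℝ, ℂ)
            (fun y => α * (leafFunction U V ε y - a₀) + β * conj (leafFunction U V ε y - a₀)) p
            (JX p v)) =
          Complex.I * (show ℂ from mfderiv (𝓡 4) 𝓘(ℝ, ℂ)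
            (fun y => α * (leafFunction U V ε y - a₀) + β * conj (leafFunction U V ε y - a₀)) p
            v)) ∧
      (∀ v : TangentSpace (𝓡 4) p, mfderiv (𝓡 4) 𝓘(ℝ, ℂ) (leafFunction U V ε) p v ≠ 0 →
        (‖β‖ < ‖α‖ ↔ 0 < ((show ℂ from mfderiv (𝓡 4) 𝓘(ℝ, ℂ) (leafFunction U V ε) p (JX p v)) *
          conj (show ℂ from mfderiv (𝓡 4) 𝓘(ℝ, ℂ) (leafFunction U V ε) p v)).im) ∧
        (‖α‖ < ‖β‖ ↔ ((show ℂ from mfderiv (𝓡 4) 𝓘(ℝ, ℂ) (leafFunction U V ε) p (JX p v)) *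
          conj (show ℂ from mfderiv (𝓡 4) 𝓘(ℝ, ℂ) (leafFunction U V ε) p v)).im < 0)) ∧
      (∃ V' ∈ 𝓝 (0 : ℂ), ∃ W' ∈ 𝓝 (G 0), W' ⊆ (⋃ a ∈ ball (0 : ℂ) ε, (range (U a) ∪ {V a 0})) ∧
        {x | x ∈ W' ∧ α * (leafFunction U V ε x - a₀) + β * conj (leafFunction U V ε x - a₀) = 0} =
          G '' V') := by
  dsimp only
  obtain ⟨hUa, hVa, hUV, hJU, hJV, hinj, himmU, himmV, hnot⟩ := hleaf a₀ ha₀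
  obtain ⟨G, hG, hGJ, hG0, hGinj, hGr, hGcov⟩ :=
    exists_localParam_of_mem_twoChart hUa hVa hUV hJU hJV hinj himmU himmV hnot hp
  -- the point is swept
  have hpW : p ∈ ⋃ a ∈ ball (0 : ℂ) ε, (range (U a) ∪ {V a 0}) :=
    mem_iUnion₂.2 ⟨a₀, by simpa using ha₀, hp⟩
  have hW := isOpen_sweep hleaf hUs hVs himm
  have hAp : MDifferentiableAt (𝓡 4) 𝓘(ℝ, ℂ) (leafFunction U V ε) p :=
    ((contMDiffOn_leafFunction hleaf hUs hVs hdisj himm).contMDiffAt (hW.mem_nhds hpW)).mdifferentiableAt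
      (by simp)
  -- the complex linearisation of `dA_p`
  set L : TangentSpace (𝓡 4) p →ₗ[ℝ] ℂ := (mfderiv (𝓡 4) 𝓘(ℝ, ℂ) (leafFunction U V ε) p).toLinearMap
    with hL
  set Jl : TangentSpace (𝓡 4) p →ₗ[ℝ] TangentSpace (𝓡 4) p :=
    (JX p : TangentSpace (𝓡 4) p →L[ℝ] TangentSpace (𝓡 4) p).toLinearMap with hJl
  have hkerp : ∀ w, L w = 0 → L (Jl w) = 0 := fun w hw =>
    mfderiv_leafFunction_J_eq_zero hleaf hUs hVs hdisj himm hpW hw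
  have hsurjp : Surjective L := surjective_mfderiv_leafFunction hleaf hUs hVs hdisj himm hpW
  obtain ⟨α, β, hne, hlin, hpos, hneg⟩ :=
    exists_complexLinearisation Jl L (fun w => JX.map_map p w) hkerp hsurjp
  refine ⟨G, α, β, hG, hGJ, hG0, hGinj, hGr, hne, fun v => ?_, fun v hv => ⟨hpos v hv, hneg v hv⟩, ?_⟩
  · rw [mfderiv_postCompose_apply hAp, mfderiv_postCompose_apply hAp]
    exact hlin v
  · -- the local zero set
    obtain ⟨C, hC, hpC, hcov⟩ := hGcov 1 one_pos
    refine ⟨ball 0 1 ∩ G ⁻¹' Cᶜ, ?_, (⋃ a ∈ ball (0 : ℂ) ε, (range (U a) ∪ {V a 0})) ∩ Cᶜ, ?_,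
      inter_subset_left, ?_⟩
    · refine Filter.inter_mem (ball_mem_nhds 0 one_pos) (hG.continuous.continuousAt.preimage_mem_nhds
        (hC.isOpen_compl.mem_nhds ?_))
      rwa [hG0]
    · rw [hG0]
      exact (hW.inter hC.isOpen_compl).mem_nhds ⟨hpW, hpC⟩
    · ext x
      simp only [mem_setOf_eq, mem_inter_iff, mem_compl_iff, mem_image, mem_preimage]
      constructor
      · rintro ⟨⟨hxW, hxC⟩, hx0⟩
        have hxa : leafFunction U V ε x = a₀ := (postCompose_eq_zero_iff hne a₀ x).1 hx0
        have hxleaf : x ∈ range (U a₀) ∪ {V a₀ 0} := by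
          rw [← leafFunction_levelSet hleaf hdisj ha₀]
          exact ⟨hxW, hxa⟩
        rcases hcov hxleaf with ⟨z, hz, rfl⟩ | hxC'
        · exact ⟨z, ⟨hz, hxC⟩, rfl⟩
        · exact absurd hxC' hxC
      · rintro ⟨z, ⟨hz, hzC⟩, rfl⟩
        have hzleaf : G z ∈ range (U a₀) ∪ {V a₀ 0} := hGr ⟨z, rfl⟩
        have hzW : G z ∈ ⋃ a ∈ ball (0 : ℂ) ε, (range (U a) ∪ {V a 0}) :=
          mem_iUnion₂.2 ⟨a₀, by simpa using ha₀, hzleaf⟩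
        refine ⟨⟨hzW, hzC⟩, ?_⟩
        rw [postCompose_eq_zero_iff hne a₀]
        have := (leafFunction_levelSet hleaf hdisj ha₀).symm.subset hzleaf
        exact this.2

end Package

end Literature.Geometry.Symplectic

end
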